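import Literature.NumberTheory.Automorphic.AutomorphicFormsL2DerivativeIntegral
import Literature.NumberTheory.Automorphic.AutomorphicRepCuspidalPart
import Literature.NumberTheory.Automorphic.GLnSiegelHeightIntegrability
import Literature.NumberTheory.Automorphic.AutomorphicMeasureSiegelDomination
import Literature.NumberTheory.Automorphic.AdelicHeightGLContinuity
import Mathlib.Topology.Order.Compact
import HarnessLib

/-!
# Borel's lemma: integration by parts on the automorphic quotient for a function of moderate
# growth against a cusp form (`∫ (X Φ) φ̄ dμ = - ∫ Φ (X φ)‾ dμ`)

Topic `NumberTheory/Automorphic`; namespace `Literature.NumberTheory.Automorphic`. Proof file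
(theorems only: no definition, no named fact, no `sorry`); sibling of
`AutomorphicLieDerivSkewAdjoint` (the square-integrable case, by unitarity) and of
`AutomorphicFormsL2DerivativeIntegral`.

**The lemma** (the identity `(Xφ, ψ) = -(φ, Xψ)` of Borel 1997, 11.12 (2), printed p. 95, proved
there for `φ, ψ ∈ H^∞ ⊂ L²` "based on the fact that the right translations `r_g` define unitary
operators", here for `φ` of moderate growth against a rapidly decreasing `ψ`, the pairing being
absolutely convergent; Getz–Hahn 2024, Thm. 9.8.1 for the rapid decay of cusp forms): let
`μ` be an automorphic measure on `GL_n(𝔸_K) ⧸ A_G GL_n(K)` (finite, invariant), `X ∈ 𝔤 = 𝔤𝔩_n(K_∞)`,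
`Φ` a continuous function on the quotient, smooth in the archimedean variable, such that `Φ` and
its Lie derivative `X Φ` have MODERATE GROWTH (`HasModerateGrowth`: `|·(g)| ≤ C (1 ⊔ ‖g‖)^r` for the
adelic height), and `φ` a function on the quotient which, together with `X φ`, is continuous and
RAPIDLY DECREASING on Siegel sets (`IsRapidlyDecreasingGL`; e.g. a cusp form invariant under
`A_G`). Then

  `∫ (X Φ) · φ̄ dμ = - ∫ Φ · (X φ)‾ dμ`   (`integral_lieDeriv_mul_conj_eq_neg_of_hasModerateGrowth`),

both integrands being integrable; for `φ = invQuot g` in the space of cusp forms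
`𝒜₀ = cuspFormsGL n K hcpt` every hypothesis on the cusp-form side is a theorem of the tree
(`integral_lieDeriv_mul_conj_cuspFormsGL_eq_neg`, `integral_descend_lieDeriv_mul_conj_cuspFormsGL_eq_neg`).
This is the analytic input of the injectivity of cuspidal cohomology in the bottom degree (a
cuspidal harmonic form has no `G(K)`-invariant primitive of moderate growth: pair the primitive
against the form, `KugaDegreeOneInjectivity`) and of the Maass–Selberg relations.

**The proof** (§2, for any adelic group datum `𝒢`, automorphy datum `𝒟` and automorphic measure,
under an abstract domination hypothesis; §3 discharges the domination for `GL_n` by reduction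
theory).  No translate of the cusp form is ever estimated: with `h_s = exp sX` and
`I(t) = ∫ Φ(h_t⁻¹ • y) φ̄(y) dμ(y)`,
* `I(t) - I(0) = ∫₀ᵗ (∫ (XΦ)(h_s⁻¹ • y) φ̄(y) dμ) ds` — the fundamental theorem of calculus along
  `exp sX` (`apply_inv_smul_sub_eq_intervalIntegral`) and Fubini, the integrand being dominated by
  `w(y) |φ(y)|` where `w(y) = sup_{|s| ≤ 1} (|Φ(h_s • y)| + |(XΦ)(h_s⁻¹ • y)|)` is continuous and, by
  submultiplicativity of the height, again of moderate growth; the inner integral is continuous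
  in `s` (dominated convergence), so `I'(0) = ∫ (XΦ) φ̄`;
* `I(t) = ∫ Φ(y) φ̄(h_{-t}⁻¹ • y) dμ(y)` by the INVARIANCE of `μ`, and the same computation on the
  `φ`-side — where Fubini and the continuity are justified by moving each translate back onto
  `Φ` with the invariance of `μ` (`∫ |Φ(y)| |Xφ(h_s⁻¹ • y)| dμ = ∫ |Φ(h_s • y)| |Xφ(y)| dμ`) — gives
  `I'(0) = - ∫ Φ (Xφ)‾`;
* `w |φ|`, `w |Xφ|` are integrable over the quotient: the quotient integral is dominated by a
  Siegel-set integral (`exists_lintegral_le_mul_setLIntegral_siegel`, reduction theory), on which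
  "rapidly decreasing × power of the height" is integrable
  (`setLIntegral_siegel_enorm_mul_height_rpow_lt_top`, Moeglin–Waldspurger I.2.2 (vii), I.2.18).

Contents: `integrable_prod_mul_comp_curve_inv_smul`, `integrable_prod_mul_comp_curve_inv_smul_of_smul`
(Fubini set-ups), `integral_lieDeriv_mul_conj_eq_neg_of_dominated` (§2, generic),
`exists_weight_of_hasModerateGrowth`, `integrable_weight_mul_norm_of_isRapidlyDecreasingGL`,
`integral_lieDeriv_mul_conj_eq_neg_of_hasModerateGrowth`,
`integral_lieDeriv_mul_conj_cuspFormsGL_eq_neg`, `integral_descend_lieDeriv_mul_conj_cuspFormsGL_eq_neg`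
(§3–4, `GL_n`); `integral_conj_lieDeriv_mul_add_eq_zero_of_hasModerateGrowth`,
`integral_conj_lieDeriv_mul_add_eq_zero_cuspFormsGL` (§5, conjugation on the moderate-growth side).

## References

* A. Borel, *Automorphic forms on SL₂(ℝ)*, Cambridge Tracts in Math. 130 (1997), 11.12 (2),
  printed p. 95 (held) [Borel1997].
* C. Moeglin, J.-L. Waldspurger, *Spectral decomposition and Eisenstein series* (1995), I.2.2
  (heights), I.2.12 (rapidly decreasing functions) (held) [MoeglinWaldspurger1995].
* J. R. Getz, H. Hahn, *An Introduction to Automorphic Representations* (2024), Def. 9.3,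
  Thm. 9.8.1 (printed p. 191), Thm. 2.7.2 (held) [GetzHahn2024].
* G. Harder, *Eisenstein cohomology of arithmetic groups. The case GL₂*, Invent. Math. 89
  (1987), §3 (not held; context for the application to the Eichler–Shimura–Harder map)
  [Harder1987].
-/

open scoped MatrixGroups Matrix ContDiff Classical Topology ComplexConjugate NNReal ENNReal Pointwise Interval
open NumberField IsDedekindDomain Filter Set
open _root_.MeasureTheory _root_.MeasureTheory.Measure

noncomputable section

namespace Literature.NumberTheory.Automorphic

/-! ### 1. One-parameter subgroups: inverses; Fubini set-ups on `ℝ × (G(𝔸_K) ⧸ A_G G(K))` -/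

section Generic

variable {K : Type} [Field K] [NumberField K] {𝒢 : AdelicGroupData K}
  {μ : Measure 𝒢.automorphicQuotient} [𝒢.IsAutomorphicMeasure μ]
  {A : Type*} [NormedCommRing A] [NormedAlgebra ℝ A] [NormedAlgebra ℚ A] [CompleteSpace A]
  [StarRing A] {N : Type*} [Fintype N] [DecidableEq N] (𝒟 : AutomorphyDatum 𝒢 A N)

omit [𝒢.IsAutomorphicMeasure μ] in
/-- `exp (-sX) = (exp sX)⁻¹` in `G_∞` (one-parameter subgroup, `RealMatrixGroup.expMem_add_smul`).
Knapp, *Lie Groups Beyond an Introduction*, 0.§2. [folklore] -/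
theorem AutomorphyDatum.expMem_neg_smul (s : ℝ) (X : 𝒟.arch.lie) :
    𝒟.arch.expMem ((-s) • X) = (𝒟.arch.expMem (s • X))⁻¹ := by
  refine eq_inv_of_mul_eq_one_right ?_
  rw [← RealMatrixGroup.expMem_add_smul, add_neg_cancel, RealMatrixGroup.expMem_zero_smul]

omit [𝒢.IsAutomorphicMeasure μ] in
/-- `exp (-sX) = (exp sX)⁻¹` in `G(𝔸_K)`, through the archimedean inclusion of an automorphy
datum. [folklore] -/
theorem AutomorphyDatum.ofArch_expMem_neg_smul (s : ℝ) (X : 𝒟.arch.lie) :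
    𝒟.ofArch (𝒟.arch.expMem ((-s) • X)) = (𝒟.ofArch (𝒟.arch.expMem (s • X)))⁻¹ := by
  rw [AutomorphyDatum.expMem_neg_smul, map_inv]

/-- **Fubini set-up, pointwise domination.** For a continuous curve `d` in `G(𝔸_K)`, a finite
measure `ρ` on `ℝ` carried by `S`, continuous `F, ψ` on the quotient and an integrable `B` with
`‖F ((d s)⁻¹ • y) ψ(y)‖ ≤ B y` for `s ∈ S`, the function `(s, y) ↦ F ((d s)⁻¹ • y) ψ(y)` is
integrable for `ρ ⊗ μ` (Mathlib `integrable_prod_iff`). [folklore] -/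
theorem integrable_prod_mul_comp_curve_inv_smul {d : ℝ → 𝒢.Adelic} (hd : Continuous d)
    (ρ : Measure ℝ) [IsFiniteMeasure ρ] {S : Set ℝ} (hρS : ∀ᵐ s ∂ρ, s ∈ S)
    {F ψ : 𝒢.automorphicQuotient → ℂ} (hF : Continuous F) (hψ : Continuous ψ)
    {B : 𝒢.automorphicQuotient → ℝ} (hB : Integrable B μ)
    (hbound : ∀ s ∈ S, ∀ y, ‖F ((d s)⁻¹ • y) * ψ y‖ ≤ B y) :
    Integrable (fun p : ℝ × 𝒢.automorphicQuotient ↦ F ((d p.1)⁻¹ • p.2) * ψ p.2) (ρ.prod μ) := by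
  have hm : AEStronglyMeasurable
      (fun p : ℝ × 𝒢.automorphicQuotient ↦ F ((d p.1)⁻¹ • p.2) * ψ p.2) (ρ.prod μ) :=
    ((hF.comp (((hd.comp continuous_fst).inv).smul continuous_snd)).mul
      (hψ.comp continuous_snd)).aestronglyMeasurable
  rw [integrable_prod_iff hm]
  constructor
  · filter_upwards [hρS] with s hs
    exact hB.mono' ((hF.comp (continuous_const_smul _)).mul hψ).aestronglyMeasurable
      (Eventually.of_forall (hbound s hs))
  · refine (integrable_const (∫ y, B y ∂μ)).mono' hm.norm.integral_prod_right' ?_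
    filter_upwards [hρS] with s hs
    rw [Real.norm_of_nonneg (integral_nonneg fun _ ↦ norm_nonneg _)]
    exact integral_mono_of_nonneg (Eventually.of_forall fun _ ↦ norm_nonneg _) hB
      (Eventually.of_forall (hbound s hs))

/-- **Fubini set-up, domination after an invariant change of variables.** As
`integrable_prod_mul_comp_curve_inv_smul`, for `(s, y) ↦ ψ(y) F ((d s)⁻¹ • y)` when the bound is
on `‖ψ ((d s) • z) F(z)‖` (the translate moved onto `ψ` by the invariance of `μ`): each fibre is
the composition of `z ↦ ψ ((d s) • z) F(z)` with the measure-preserving `y ↦ (d s)⁻¹ • y`. This is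
how a translate of a cusp form paired with a function of moderate growth is controlled without
estimating the translate. [folklore] -/
theorem integrable_prod_mul_comp_curve_inv_smul_of_smul {d : ℝ → 𝒢.Adelic} (hd : Continuous d)
    (ρ : Measure ℝ) [IsFiniteMeasure ρ] {S : Set ℝ} (hρS : ∀ᵐ s ∂ρ, s ∈ S)
    {F ψ : 𝒢.automorphicQuotient → ℂ} (hF : Continuous F) (hψ : Continuous ψ)
    {B : 𝒢.automorphicQuotient → ℝ} (hB : Integrable B μ)
    (hbound : ∀ s ∈ S, ∀ z, ‖ψ ((d s) • z) * F z‖ ≤ B z) :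
    Integrable (fun p : ℝ × 𝒢.automorphicQuotient ↦ ψ p.2 * F ((d p.1)⁻¹ • p.2)) (ρ.prod μ) := by
  have hm : AEStronglyMeasurable
      (fun p : ℝ × 𝒢.automorphicQuotient ↦ ψ p.2 * F ((d p.1)⁻¹ • p.2)) (ρ.prod μ) :=
    ((hψ.comp continuous_snd).mul
      (hF.comp (((hd.comp continuous_fst).inv).smul continuous_snd))).aestronglyMeasurable
  -- the fibre over `s` is `(z ↦ ψ ((d s) • z) F z) ∘ (y ↦ (d s)⁻¹ • y)`
  have hfib : ∀ s, (fun y : 𝒢.automorphicQuotient ↦ ψ y * F ((d s)⁻¹ • y)) =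
      (fun z ↦ ψ ((d s) • z) * F z) ∘ fun y ↦ (d s)⁻¹ • y := by
    intro s
    funext y
    simp only [Function.comp_apply, smul_inv_smul]
  have hInt : ∀ s ∈ S, Integrable (fun z : 𝒢.automorphicQuotient ↦ ψ ((d s) • z) * F z) μ :=
    fun s hs ↦ hB.mono' ((hψ.comp (continuous_const_smul _)).mul hF).aestronglyMeasurable
      (Eventually.of_forall (hbound s hs))
  rw [integrable_prod_iff hm]
  constructor
  · filter_upwards [hρS] with s hs
    change Integrable (fun y : 𝒢.automorphicQuotient ↦ ψ y * F ((d s)⁻¹ • y)) μ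
    rw [hfib s]
    exact (measurePreserving_smul (d s)⁻¹ μ).integrable_comp_of_integrable (hInt s hs)
  · refine (integrable_const (∫ y, B y ∂μ)).mono' hm.norm.integral_prod_right' ?_
    filter_upwards [hρS] with s hs
    rw [Real.norm_of_nonneg (integral_nonneg fun _ ↦ norm_nonneg _)]
    have e : (∫ y, ‖ψ y * F ((d s)⁻¹ • y)‖ ∂μ) = ∫ z, ‖ψ ((d s) • z) * F z‖ ∂μ := by
      have h := integral_smul_eq_self (μ := μ) (fun z ↦ ‖ψ ((d s) • z) * F z‖) (g := (d s)⁻¹)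
      simp only [smul_inv_smul] at h
      exact h
    change (∫ y, ‖ψ y * F ((d s)⁻¹ • y)‖ ∂μ) ≤ ∫ y, B y ∂μ
    rw [e]
    exact integral_mono_of_nonneg (Eventually.of_forall fun _ ↦ norm_nonneg _) hB
      (Eventually.of_forall (hbound s hs))

omit [𝒢.IsAutomorphicMeasure μ] in
/-- Lie derivatives (through right translation) of functions invariant on the left under a set of
elements are invariant under it (left and right translations commute). [folklore] -/
theorem lieDeriv_apply_mul_of_forall_apply_mul {Φ : 𝒢.Adelic → ℂ} {S : Subgroup 𝒢.Adelic}
    (hΦ : ∀ γ ∈ S, ∀ x, Φ (γ * x) = Φ x) (X : 𝒟.arch.lie) :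
    ∀ γ ∈ S, ∀ x, lieDeriv 𝒟.ofArch X Φ (γ * x) = lieDeriv 𝒟.ofArch X Φ x := by
  intro γ hγ x
  simp only [lieDeriv, mul_assoc, hΦ γ hγ]

omit [𝒢.IsAutomorphicMeasure μ] in
/-- Complex conjugation commutes with interval integrals (Mathlib `integral_conj` on both
half-line pieces). [folklore] -/
theorem intervalIntegral_conj (u : ℝ → ℂ) (a b : ℝ) :
    ∫ s in a..b, conj (u s) = conj (∫ s in a..b, u s) := by
  simp only [intervalIntegral, integral_conj, map_sub]

/-! ### 2. The generic lemma: integration by parts under domination -/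

/-- **Integration by parts on the automorphic quotient under domination (Borel's lemma, abstract
form).** Let `μ` be an automorphic measure, `X ∈ 𝔤`, and `f, f_X, g, g_X` continuous functions on
`G(𝔸_K) ⧸ A_G G(K)` with `invQuot f`, `invQuot g` smooth in the archimedean variable,
`X (invQuot f) = invQuot f_X`, `X (invQuot g) = invQuot g_X`. Suppose there is a weight `w` with
`w |g|`, `w |g_X|` integrable and `|f (exp(sX) • y)| ≤ w y`, `|f_X (exp(sX)⁻¹ • y)| ≤ w y` for
`|s| ≤ 1`. Then `∫ f_X ḡ dμ = - ∫ f ḡ_X dμ`. Proof in the module docstring: both sides are the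
derivative at `0` of `t ↦ ∫ f (exp(tX)⁻¹ • y) ḡ(y) dμ = ∫ f(y) ḡ(exp(-tX)⁻¹ • y) dμ` (invariance of
`μ`), computed by the fundamental theorem of calculus along `exp sX`, Fubini, and dominated
convergence, the translates on the `g`-side being moved onto `f` by invariance.
Borel 1997, 11.12 (2) (the computation, for square integrable data). [cite: Borel1997, 11.12 (2)] -/
theorem integral_lieDeriv_mul_conj_eq_neg_of_dominated {f f_X g g_X : 𝒢.automorphicQuotient → ℂ}
    (hfc : Continuous f) (hfXc : Continuous f_X) (hgc : Continuous g) (hgXc : Continuous g_X)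
    (hφ : IsArchSmooth 𝒟.ofArch (invQuot 𝒢 f)) (hψ : IsArchSmooth 𝒟.ofArch (invQuot 𝒢 g))
    (X : 𝒟.arch.lie) (hXf : lieDeriv 𝒟.ofArch X (invQuot 𝒢 f) = invQuot 𝒢 f_X)
    (hXg : lieDeriv 𝒟.ofArch X (invQuot 𝒢 g) = invQuot 𝒢 g_X) {w : 𝒢.automorphicQuotient → ℝ}
    (hwg : Integrable (fun y ↦ w y * ‖g y‖) μ) (hwgX : Integrable (fun y ↦ w y * ‖g_X y‖) μ)
    (hwf : ∀ s ∈ Icc (-1 : ℝ) 1, ∀ y, ‖f (𝒟.ofArch (𝒟.arch.expMem (s • X)) • y)‖ ≤ w y)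
    (hwfX : ∀ s ∈ Icc (-1 : ℝ) 1, ∀ y, ‖f_X ((𝒟.ofArch (𝒟.arch.expMem (s • X)))⁻¹ • y)‖ ≤ w y) :
    ∫ y, f_X y * conj (g y) ∂μ = -∫ y, f y * conj (g_X y) ∂μ := by
  -- the curve `d s = exp sX` and its algebra
  set d : ℝ → 𝒢.Adelic := fun s ↦ 𝒟.ofArch (𝒟.arch.expMem (s • X)) with hd_def
  have hd : Continuous d := 𝒟.continuous_ofArch_expMem_smul X
  have hdneg : ∀ s, d (-s) = (d s)⁻¹ := fun s ↦ 𝒟.ofArch_expMem_neg_smul s X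
  have hd0 : d 0 = 1 := by
    simp only [hd_def, RealMatrixGroup.expMem_zero_smul, map_one]
  have hIcc_neg : ∀ s ∈ Icc (-1 : ℝ) 1, -s ∈ Icc (-1 : ℝ) 1 := fun s hs ↦
    ⟨by linarith [hs.2], by linarith [hs.1]⟩
  have hIcc0 : (0 : ℝ) ∈ Icc (-1 : ℝ) 1 := ⟨by norm_num, by norm_num⟩
  have hIcc_nhds : Icc (-1 : ℝ) 1 ∈ 𝓝 (0 : ℝ) := Icc_mem_nhds (by norm_num) (by norm_num)
  have huIoc : ∀ t ∈ Icc (-1 : ℝ) 1, ∀ s ∈ Ι (0 : ℝ) t, s ∈ Icc (-1 : ℝ) 1 := by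
    intro t ht s hs
    rw [Set.mem_uIoc] at hs
    rcases hs with ⟨h1, h2⟩ | ⟨h1, h2⟩
    · exact ⟨by linarith, h2.trans ht.2⟩
    · exact ⟨by linarith [ht.1], by linarith [hIcc0.2]⟩
  -- translates of `f` by `(d s)⁻¹` are dominated by `w` as well
  have hwf' : ∀ s ∈ Icc (-1 : ℝ) 1, ∀ y, ‖f ((d s)⁻¹ • y)‖ ≤ w y := by
    intro s hs y
    rw [← hdneg]
    exact hwf (-s) (hIcc_neg s hs) y
  have hw0 : ∀ y, 0 ≤ w y := fun y ↦ (norm_nonneg _).trans (hwfX 0 hIcc0 y)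
  -- the parametrised integrals
  set G₁ : ℝ → ℂ := fun s ↦ ∫ y, f_X ((d s)⁻¹ • y) * conj (g y) ∂μ with hG₁
  set G₂ : ℝ → ℂ := fun s ↦ ∫ y, f ((d s) • y) * conj (g_X y) ∂μ with hG₂
  set I : ℝ → ℂ := fun t ↦ ∫ y, f ((d t)⁻¹ • y) * conj (g y) ∂μ with hI
  -- pointwise bounds in the form `‖·‖ ≤ w y * ‖g y‖`
  have hb₁ : ∀ s ∈ Icc (-1 : ℝ) 1, ∀ y, ‖f_X ((d s)⁻¹ • y) * conj (g y)‖ ≤ w y * ‖g y‖ := by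
    intro s hs y
    rw [norm_mul, Complex.norm_conj]
    exact mul_le_mul_of_nonneg_right (hwfX s hs y) (norm_nonneg _)
  have hb₀ : ∀ s ∈ Icc (-1 : ℝ) 1, ∀ y, ‖f ((d s)⁻¹ • y) * conj (g y)‖ ≤ w y * ‖g y‖ := by
    intro s hs y
    rw [norm_mul, Complex.norm_conj]
    exact mul_le_mul_of_nonneg_right (hwf' s hs y) (norm_nonneg _)
  have hb₂ : ∀ s ∈ Icc (-1 : ℝ) 1, ∀ z, ‖f ((d s) • z) * conj (g_X z)‖ ≤ w z * ‖g_X z‖ := by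
    intro s hs z
    rw [norm_mul, Complex.norm_conj]
    exact mul_le_mul_of_nonneg_right (hwf s hs z) (norm_nonneg _)
  have hb₃ : ∀ s ∈ Icc (-1 : ℝ) 1, ∀ z, ‖f ((d s) • z) * conj (g z)‖ ≤ w z * ‖g z‖ := by
    intro s hs z
    rw [norm_mul, Complex.norm_conj]
    exact mul_le_mul_of_nonneg_right (hwf s hs z) (norm_nonneg _)
  -- continuity of the integrands in `y` for fixed `s`
  have hcont₁ : ∀ s, Continuous fun y ↦ f_X ((d s)⁻¹ • y) * conj (g y) := fun s ↦
    (hfXc.comp (continuous_const_smul _)).mul (Complex.continuous_conj.comp hgc)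
  have hcont₀ : ∀ s, Continuous fun y ↦ f ((d s)⁻¹ • y) * conj (g y) := fun s ↦
    (hfc.comp (continuous_const_smul _)).mul (Complex.continuous_conj.comp hgc)
  have hcont₂ : ∀ s, Continuous fun y ↦ f ((d s) • y) * conj (g_X y) := fun s ↦
    (hfc.comp (continuous_const_smul _)).mul (Complex.continuous_conj.comp hgXc)
  -- integrability of the integrands for `|s| ≤ 1`
  have hint₁ : ∀ s ∈ Icc (-1 : ℝ) 1, Integrable (fun y ↦ f_X ((d s)⁻¹ • y) * conj (g y)) μ :=
    fun s hs ↦ hwg.mono' (hcont₁ s).aestronglyMeasurable (Eventually.of_forall (hb₁ s hs))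
  have hint₀ : ∀ s ∈ Icc (-1 : ℝ) 1, Integrable (fun y ↦ f ((d s)⁻¹ • y) * conj (g y)) μ :=
    fun s hs ↦ hwg.mono' (hcont₀ s).aestronglyMeasurable (Eventually.of_forall (hb₀ s hs))
  have hint₂ : ∀ s ∈ Icc (-1 : ℝ) 1, Integrable (fun y ↦ f ((d s) • y) * conj (g_X y)) μ :=
    fun s hs ↦ hwgX.mono' (hcont₂ s).aestronglyMeasurable (Eventually.of_forall (hb₂ s hs))
  -- `y ↦ f y * conj (g_X ((d s)⁻¹ • y))` and `y ↦ f y * conj (g ((d s)⁻¹ • y))`: integrable, and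
  -- their integrals are `G₂ s`, resp. `∫ f ((d s) • z) conj (g z)`, by invariance
  have hfib : ∀ (u : 𝒢.automorphicQuotient → ℂ) (s : ℝ),
      (fun y : 𝒢.automorphicQuotient ↦ f y * conj (u ((d s)⁻¹ • y))) =
        (fun z ↦ f ((d s) • z) * conj (u z)) ∘ fun y ↦ (d s)⁻¹ • y := by
    intro u s
    funext y
    simp only [Function.comp_apply, smul_inv_smul]
  have hinv_int : ∀ (u : 𝒢.automorphicQuotient → ℂ) (s : ℝ),
      (∫ y, f y * conj (u ((d s)⁻¹ • y)) ∂μ) = ∫ z, f ((d s) • z) * conj (u z) ∂μ := by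
    intro u s
    have h := integral_smul_eq_self (μ := μ) (fun z ↦ f ((d s) • z) * conj (u z)) (g := (d s)⁻¹)
    simp only [smul_inv_smul] at h
    exact h
  have hint₂' : ∀ s ∈ Icc (-1 : ℝ) 1, Integrable (fun y ↦ f y * conj (g_X ((d s)⁻¹ • y))) μ := by
    intro s hs
    rw [hfib g_X s]
    exact (measurePreserving_smul (d s)⁻¹ μ).integrable_comp_of_integrable (hint₂ s hs)
  have hint₃' : ∀ s ∈ Icc (-1 : ℝ) 1, Integrable (fun y ↦ f y * conj (g ((d s)⁻¹ • y))) μ := by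
    intro s hs
    rw [hfib g s]
    have hint₃ : Integrable (fun z ↦ f ((d s) • z) * conj (g z)) μ :=
      hwg.mono' ((hfc.comp (continuous_const_smul _)).mul
        (Complex.continuous_conj.comp hgc)).aestronglyMeasurable (Eventually.of_forall (hb₃ s hs))
    exact (measurePreserving_smul (d s)⁻¹ μ).integrable_comp_of_integrable hint₃
  -- continuity of `G₁`, `G₂` on `[-1, 1]` (dominated convergence)
  have hG₁c : ContinuousOn G₁ (Icc (-1 : ℝ) 1) := by
    refine continuousOn_of_dominated (fun s _ ↦ (hcont₁ s).aestronglyMeasurable)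
      (fun s hs ↦ Eventually.of_forall (hb₁ s hs)) hwg (Eventually.of_forall fun y ↦ ?_)
    exact (((hfXc.comp ((hd.inv).smul continuous_const))).mul continuous_const).continuousOn
  have hG₂c : ContinuousOn G₂ (Icc (-1 : ℝ) 1) := by
    refine continuousOn_of_dominated (fun s _ ↦ (hcont₂ s).aestronglyMeasurable)
      (fun s hs ↦ Eventually.of_forall (hb₂ s hs)) hwgX (Eventually.of_forall fun y ↦ ?_)
    exact ((hfc.comp (hd.smul continuous_const)).mul continuous_const).continuousOn
  -- Step 1: `I t - I 0 = ∫₀ᵗ G₁` for `|t| ≤ 1`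
  have hI0 : I 0 = ∫ y, f y * conj (g y) ∂μ := by
    simp only [hI, hd0, inv_one, one_smul]
  have hstep1 : ∀ t ∈ Icc (-1 : ℝ) 1, I t = I 0 + ∫ s in (0 : ℝ)..t, G₁ s := by
    intro t ht
    -- Fubini on the two half pieces
    have hprod : ∀ a b : ℝ, Set.Ioc a b ⊆ Ι 0 t →
        Integrable (fun p : ℝ × 𝒢.automorphicQuotient ↦ f_X ((d p.1)⁻¹ • p.2) * conj (g p.2))
          ((volume.restrict (Set.Ioc a b)).prod μ) := by
      intro a b hab
      haveI : IsFiniteMeasure (volume.restrict (Set.Ioc a b)) := ⟨by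
        rw [Measure.restrict_apply_univ]; exact measure_Ioc_lt_top⟩
      refine integrable_prod_mul_comp_curve_inv_smul hd _ (S := Icc (-1 : ℝ) 1) ?_ hfXc
        (Complex.continuous_conj.comp hgc) hwg hb₁
      filter_upwards [ae_restrict_mem measurableSet_Ioc] with s hs
      exact huIoc t ht s (hab hs)
    have hswap : ∀ a b : ℝ, Set.Ioc a b ⊆ Ι 0 t →
        (∫ y, (∫ s in Set.Ioc a b, f_X ((d s)⁻¹ • y) * conj (g y)) ∂μ) =
          ∫ s in Set.Ioc a b, G₁ s := by
      intro a b hab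
      exact (integral_integral_swap (hprod a b hab)).symm
    have hpiece : ∀ a b : ℝ, Set.Ioc a b ⊆ Ι 0 t →
        Integrable (fun y ↦ ∫ s in Set.Ioc a b, f_X ((d s)⁻¹ • y) * conj (g y)) μ := by
      intro a b hab
      exact (hprod a b hab).integral_prod_right
    have hsub1 : Set.Ioc 0 t ⊆ Ι 0 t := fun s hs ↦ by
      rw [Set.mem_uIoc]; exact Or.inl hs
    have hsub2 : Set.Ioc t 0 ⊆ Ι 0 t := fun s hs ↦ by
      rw [Set.mem_uIoc]; exact Or.inr hs
    calc I t = I 0 + (I t - I 0) := by ring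
      _ = I 0 + ∫ y, (f ((d t)⁻¹ • y) - f y) * conj (g y) ∂μ := by
          congr 1
          rw [hI0]
          change (∫ y, f ((d t)⁻¹ • y) * conj (g y) ∂μ) - _ = _
          rw [← integral_sub (hint₀ t ht)]
          · refine integral_congr_ae (Eventually.of_forall fun y ↦ ?_)
            simp only [sub_mul]
          · simpa only [hd0, inv_one, one_smul] using hint₀ 0 hIcc0
      _ = I 0 + ∫ y, (∫ s in (0 : ℝ)..t, f_X ((d s)⁻¹ • y) * conj (g y)) ∂μ := by
          congr 1
          refine integral_congr_ae (Eventually.of_forall fun y ↦ ?_)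
          change (f ((d t)⁻¹ • y) - f y) * conj (g y) = _
          rw [apply_inv_smul_sub_eq_intervalIntegral 𝒟 hφ X hXf y t,
            ← intervalIntegral.integral_mul_const]
      _ = I 0 + ∫ s in (0 : ℝ)..t, G₁ s := by
          congr 1
          simp only [intervalIntegral]
          rw [integral_sub (hpiece 0 t hsub1) (hpiece t 0 hsub2), hswap 0 t hsub1,
            hswap t 0 hsub2]
  -- Step 2: `I t = ∫ f · conj (g ((d (-t))⁻¹ • ·))` (invariance), `= I 0 + ∫₀^{-t} G₂`
  have hIJ : ∀ t, I t = ∫ y, f y * conj (g ((d (-t))⁻¹ • y)) ∂μ := by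
    intro t
    rw [hinv_int g (-t), hdneg]
  have hstep2 : ∀ t ∈ Icc (-1 : ℝ) 1, I t = I 0 + ∫ s in (0 : ℝ)..(-t), G₂ s := by
    intro t ht
    have ht' : -t ∈ Icc (-1 : ℝ) 1 := hIcc_neg t ht
    have hprod : ∀ a b : ℝ, Set.Ioc a b ⊆ Ι 0 (-t) →
        Integrable (fun p : ℝ × 𝒢.automorphicQuotient ↦ f p.2 * conj (g_X ((d p.1)⁻¹ • p.2)))
          ((volume.restrict (Set.Ioc a b)).prod μ) := by
      intro a b hab
      haveI : IsFiniteMeasure (volume.restrict (Set.Ioc a b)) := ⟨by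
        rw [Measure.restrict_apply_univ]; exact measure_Ioc_lt_top⟩
      refine integrable_prod_mul_comp_curve_inv_smul_of_smul hd _ (S := Icc (-1 : ℝ) 1) ?_
        (Complex.continuous_conj.comp hgXc) hfc hwgX ?_
      · filter_upwards [ae_restrict_mem measurableSet_Ioc] with s hs
        exact huIoc (-t) ht' s (hab hs)
      · intro s hs z
        exact hb₂ s hs z
    have hswap : ∀ a b : ℝ, Set.Ioc a b ⊆ Ι 0 (-t) →
        (∫ y, (∫ s in Set.Ioc a b, f y * conj (g_X ((d s)⁻¹ • y))) ∂μ) =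
          ∫ s in Set.Ioc a b, G₂ s := by
      intro a b hab
      rw [← integral_integral_swap (hprod a b hab)]
      refine integral_congr_ae (Eventually.of_forall fun s ↦ ?_)
      exact hinv_int g_X s
    have hpiece : ∀ a b : ℝ, Set.Ioc a b ⊆ Ι 0 (-t) →
        Integrable (fun y ↦ ∫ s in Set.Ioc a b, f y * conj (g_X ((d s)⁻¹ • y))) μ := by
      intro a b hab
      exact (hprod a b hab).integral_prod_right
    have hsub1 : Set.Ioc 0 (-t) ⊆ Ι 0 (-t) := fun s hs ↦ by
      rw [Set.mem_uIoc]; exact Or.inl hs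
    have hsub2 : Set.Ioc (-t) 0 ⊆ Ι 0 (-t) := fun s hs ↦ by
      rw [Set.mem_uIoc]; exact Or.inr hs
    calc I t = I 0 + (I t - I 0) := by ring
      _ = I 0 + ∫ y, f y * (conj (g ((d (-t))⁻¹ • y)) - conj (g y)) ∂μ := by
          congr 1
          rw [hIJ t, hI0, ← integral_sub (hint₃' (-t) ht')]
          · refine integral_congr_ae (Eventually.of_forall fun y ↦ ?_)
            simp only [mul_sub]
          · simpa only [hd0, inv_one, one_smul] using hint₀ 0 hIcc0
      _ = I 0 + ∫ y, (∫ s in (0 : ℝ)..(-t), f y * conj (g_X ((d s)⁻¹ • y))) ∂μ := by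
          congr 1
          refine integral_congr_ae (Eventually.of_forall fun y ↦ ?_)
          change f y * (conj (g ((d (-t))⁻¹ • y)) - conj (g y)) = _
          rw [← map_sub, apply_inv_smul_sub_eq_intervalIntegral 𝒟 hψ X hXg y (-t),
            ← intervalIntegral_conj, ← intervalIntegral.integral_const_mul]
      _ = I 0 + ∫ s in (0 : ℝ)..(-t), G₂ s := by
          congr 1
          simp only [intervalIntegral]
          rw [integral_sub (hpiece 0 (-t) hsub1) (hpiece (-t) 0 hsub2), hswap 0 (-t) hsub1,
            hswap (-t) 0 hsub2]
  -- Step 3: the two derivatives of `I` at `0`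
  have hIoo : Set.Ioo (-1 : ℝ) 1 ⊆ Icc (-1 : ℝ) 1 := Set.Ioo_subset_Icc_self
  have hD₁ : HasDerivAt I (G₁ 0) 0 := by
    have hprim : HasDerivAt (fun u ↦ ∫ s in (0 : ℝ)..u, G₁ s) (G₁ 0) 0 :=
      intervalIntegral.integral_hasDerivAt_right IntervalIntegrable.refl
        ((hG₁c.mono hIoo).stronglyMeasurableAtFilter isOpen_Ioo 0 ⟨by norm_num, by norm_num⟩)
        (hG₁c.continuousAt hIcc_nhds)
    refine (hprim.const_add (I 0)).congr_of_eventuallyEq ?_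
    filter_upwards [hIcc_nhds] with t ht
    exact hstep1 t ht
  have hD₂ : HasDerivAt I (-G₂ 0) 0 := by
    have hprim : HasDerivAt (fun u ↦ ∫ s in (0 : ℝ)..u, G₂ s) (G₂ 0) 0 :=
      intervalIntegral.integral_hasDerivAt_right IntervalIntegrable.refl
        ((hG₂c.mono hIoo).stronglyMeasurableAtFilter isOpen_Ioo 0 ⟨by norm_num, by norm_num⟩)
        (hG₂c.continuousAt hIcc_nhds)
    have hneg : HasDerivAt (fun u : ℝ ↦ -u) (-1) (0 : ℝ) := hasDerivAt_neg 0
    have hcomp : HasDerivAt ((fun u ↦ ∫ s in (0 : ℝ)..u, G₂ s) ∘ fun u : ℝ ↦ -u)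
        ((-1 : ℝ) • G₂ 0) 0 := by
      refine HasDerivAt.scomp (0 : ℝ) ?_ hneg
      rw [neg_zero]
      exact hprim
    rw [neg_one_smul] at hcomp
    refine (hcomp.const_add (I 0)).congr_of_eventuallyEq ?_
    filter_upwards [hIcc_nhds] with t ht
    exact hstep2 t ht
  -- conclusion
  have heq : G₁ 0 = -G₂ 0 := hD₁.unique hD₂
  have e₁ : G₁ 0 = ∫ y, f_X y * conj (g y) ∂μ := by
    simp only [hG₁, hd0, inv_one, one_smul]
  have e₂ : G₂ 0 = ∫ y, f y * conj (g_X y) ∂μ := by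
    simp only [hG₂, hd0, one_smul]
  rw [← e₁, ← e₂]
  exact heq

end Generic

/-! ### 3. `GL_n`: moderate growth against rapid decay -/

section GLn

variable {n : ℕ} {K : Type} [Field K] [NumberField K] {hcpt : isCompact_glFiniteIntegralLevel n K}

/-- A real number `C` with `a ≤ C P` for some `a ≥ 0`, `P > 0` is non-negative. [folklore] -/
private theorem nonneg_of_le_mul_of_pos {C P a : ℝ} (h : a ≤ C * P) (ha : 0 ≤ a) (hP : 0 < P) :
    0 ≤ C := by
  by_contra hC
  have hC' : C < 0 := lt_of_not_ge hC
  nlinarith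

/-- **The weight.** For `X ∈ 𝔤` and continuous `f, f_X` on the quotient whose inversions have
moderate growth, `w(y) = sup_{|s| ≤ 1} |f (exp(sX) • y)| + sup_{|s| ≤ 1} |f_X (exp(sX)⁻¹ • y)|` is a
continuous non-negative function dominating these translates, and `w([g⁻¹]) ≤ C (1 ⊔ ‖g‖)^R` for
every `g ∈ GL_n(𝔸_K)`: `f (exp(sX) • [g⁻¹]) = (invQuot f)(g exp(-sX))` and
`1 ⊔ ‖g h‖ ≤ (1 ⊔ n ‖h‖)(1 ⊔ ‖g‖)` (`one_sup_adelicHeightGL_mul_le`), `‖exp(sX)‖` being bounded for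
`|s| ≤ 1` (continuity of the height, `continuous_adelicHeightGL`). Borel–Jacquet 1979, §1.2;
Moeglin–Waldspurger 1995, I.2.2. [folklore] -/
theorem exists_weight_of_hasModerateGrowth (X : (AutomorphyDatum.gl n K hcpt).arch.lie)
    {f f_X : (AdelicGroupData.gl n K).automorphicQuotient → ℂ} (hfc : Continuous f)
    (hfXc : Continuous f_X)
    (hfm : HasModerateGrowth (AutomorphyDatum.gl n K hcpt) (invQuot (AdelicGroupData.gl n K) f))
    (hfXm : HasModerateGrowth (AutomorphyDatum.gl n K hcpt) (invQuot (AdelicGroupData.gl n K) f_X)) :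
    ∃ (w : (AdelicGroupData.gl n K).automorphicQuotient → ℝ) (C : ℝ) (R : ℕ), Continuous w ∧
      (∀ y, 0 ≤ w y) ∧
      (∀ s ∈ Icc (-1 : ℝ) 1, ∀ y,
        ‖f ((AutomorphyDatum.gl n K hcpt).ofArch
          ((AutomorphyDatum.gl n K hcpt).arch.expMem (s • X)) • y)‖ ≤ w y) ∧
      (∀ s ∈ Icc (-1 : ℝ) 1, ∀ y,
        ‖f_X (((AutomorphyDatum.gl n K hcpt).ofArch
          ((AutomorphyDatum.gl n K hcpt).arch.expMem (s • X)))⁻¹ • y)‖ ≤ w y) ∧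
      ∀ g : (AdelicGroupData.gl n K).Adelic,
        w ((AdelicGroupData.gl n K).toAutomorphicQuotient g⁻¹) ≤ C * (1 ⊔ adelicHeightGL n K g) ^ R := by
  set d : ℝ → (AdelicGroupData.gl n K).Adelic := fun s ↦
    (AutomorphyDatum.gl n K hcpt).ofArch ((AutomorphyDatum.gl n K hcpt).arch.expMem (s • X)) with hd_def
  have hd : Continuous d := (AutomorphyDatum.gl n K hcpt).continuous_ofArch_expMem_smul X
  have hdneg : ∀ s, d (-s) = (d s)⁻¹ := fun s ↦
    (AutomorphyDatum.gl n K hcpt).ofArch_expMem_neg_smul s X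
  have hK : IsCompact (Icc (-1 : ℝ) 1) := isCompact_Icc
  -- the two suprema
  set F₁ : (AdelicGroupData.gl n K).automorphicQuotient → ℝ → ℝ := fun y s ↦ ‖f ((d s) • y)‖ with hF₁
  set F₂ : (AdelicGroupData.gl n K).automorphicQuotient → ℝ → ℝ :=
    fun y s ↦ ‖f_X ((d s)⁻¹ • y)‖ with hF₂
  have hF₁c : Continuous ↿F₁ :=
    (hfc.comp ((hd.comp continuous_snd).smul continuous_fst)).norm
  have hF₂c : Continuous ↿F₂ :=
    (hfXc.comp (((hd.comp continuous_snd).inv).smul continuous_fst)).norm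
  set w : (AdelicGroupData.gl n K).automorphicQuotient → ℝ :=
    fun y ↦ sSup (F₁ y '' Icc (-1 : ℝ) 1) + sSup (F₂ y '' Icc (-1 : ℝ) 1) with hw
  have hwc : Continuous w := (hK.continuous_sSup hF₁c).add (hK.continuous_sSup hF₂c)
  have hbdd₁ : ∀ y, BddAbove (F₁ y '' Icc (-1 : ℝ) 1) := fun y ↦
    hK.bddAbove_image (hF₁c.comp (Continuous.prodMk_right y)).continuousOn
  have hbdd₂ : ∀ y, BddAbove (F₂ y '' Icc (-1 : ℝ) 1) := fun y ↦
    hK.bddAbove_image (hF₂c.comp (Continuous.prodMk_right y)).continuousOn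
  have hne : (Icc (-1 : ℝ) 1).Nonempty := ⟨0, by norm_num, by norm_num⟩
  have hsup₁_nonneg : ∀ y, 0 ≤ sSup (F₁ y '' Icc (-1 : ℝ) 1) := fun y ↦
    le_csSup_of_le (hbdd₁ y) (mem_image_of_mem _ hne.some_mem) (norm_nonneg _)
  have hsup₂_nonneg : ∀ y, 0 ≤ sSup (F₂ y '' Icc (-1 : ℝ) 1) := fun y ↦
    le_csSup_of_le (hbdd₂ y) (mem_image_of_mem _ hne.some_mem) (norm_nonneg _)
  -- the height of `d s`, `|s| ≤ 1`, is bounded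
  obtain ⟨c₀, hc₀⟩ : ∃ c₀ : ℝ, ∀ s ∈ Icc (-1 : ℝ) 1, 1 ⊔ (n : ℝ) * adelicHeightGL n K (d s) ≤ c₀ := by
    have hcts : Continuous fun s : ℝ ↦ 1 ⊔ (n : ℝ) * adelicHeightGL n K (d s) :=
      continuous_const.max (continuous_const.mul (continuous_adelicHeightGL.comp hd))
    obtain ⟨c₀, hc₀⟩ := hK.bddAbove_image hcts.continuousOn
    exact ⟨c₀, fun s hs ↦ hc₀ (mem_image_of_mem _ hs)⟩
  have hc₀1 : 1 ≤ c₀ := le_sup_left.trans (hc₀ 0 ⟨by norm_num, by norm_num⟩)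
  -- the moderate growth constants
  obtain ⟨C₁, r₁, hC₁⟩ := hfm
  obtain ⟨C₂, r₂, hC₂⟩ := hfXm
  rw [AutomorphyDatum.gl_height] at hC₁ hC₂
  set R := max r₁ r₂ with hR
  have hC₁0 : 0 ≤ C₁ :=
    nonneg_of_le_mul_of_pos (hC₁ 1) (norm_nonneg _) (pow_pos (lt_of_lt_of_le one_pos le_sup_left) _)
  have hC₂0 : 0 ≤ C₂ :=
    nonneg_of_le_mul_of_pos (hC₂ 1) (norm_nonneg _) (pow_pos (lt_of_lt_of_le one_pos le_sup_left) _)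
  -- translates: `(invQuot u) (g * d s)` is bounded by `C c₀^R (1 ⊔ ‖g‖)^R`
  have hkey : ∀ (u : (AdelicGroupData.gl n K).automorphicQuotient → ℂ) (C : ℝ) (r : ℕ), 0 ≤ C →
      r ≤ R → (∀ g, ‖invQuot (AdelicGroupData.gl n K) u g‖ ≤ C * (1 ⊔ adelicHeightGL n K g) ^ r) →
      ∀ s ∈ Icc (-1 : ℝ) 1, ∀ g : (AdelicGroupData.gl n K).Adelic,
        ‖u ((d s)⁻¹ • (AdelicGroupData.gl n K).toAutomorphicQuotient g⁻¹)‖ ≤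
          C * c₀ ^ R * (1 ⊔ adelicHeightGL n K g) ^ R := by
    intro u C r hC hr hu s hs g
    have e : u ((d s)⁻¹ • (AdelicGroupData.gl n K).toAutomorphicQuotient g⁻¹) =
        invQuot (AdelicGroupData.gl n K) u (g * d s) :=
      apply_inv_smul_toAutomorphicQuotient_inv u (d s) g
    rw [e]
    have h1 := hu (g * d s)
    have hg1 : (1 : ℝ) ≤ 1 ⊔ adelicHeightGL n K g := le_sup_left
    have h2 : 1 ⊔ adelicHeightGL n K (g * d s) ≤ c₀ * (1 ⊔ adelicHeightGL n K g) :=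
      (one_sup_adelicHeightGL_mul_le g (d s)).trans
        (mul_le_mul_of_nonneg_right (hc₀ s hs) (zero_le_one.trans hg1))
    have h3 : (1 ⊔ adelicHeightGL n K (g * d s)) ^ r ≤ (c₀ * (1 ⊔ adelicHeightGL n K g)) ^ r :=
      pow_le_pow_left₀ (zero_le_one.trans le_sup_left) h2 r
    have h4 : (c₀ * (1 ⊔ adelicHeightGL n K g)) ^ r ≤ (c₀ * (1 ⊔ adelicHeightGL n K g)) ^ R :=
      pow_le_pow_right₀ (one_le_mul_of_one_le_of_one_le hc₀1 hg1) hr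
    calc ‖invQuot (AdelicGroupData.gl n K) u (g * d s)‖ ≤ C * (1 ⊔ adelicHeightGL n K (g * d s)) ^ r := h1
      _ ≤ C * (c₀ * (1 ⊔ adelicHeightGL n K g)) ^ R :=
          mul_le_mul_of_nonneg_left (h3.trans h4) hC
      _ = C * c₀ ^ R * (1 ⊔ adelicHeightGL n K g) ^ R := by rw [mul_pow]; ring
  refine ⟨w, C₁ * c₀ ^ R + C₂ * c₀ ^ R, R, hwc, fun y ↦ add_nonneg (hsup₁_nonneg y) (hsup₂_nonneg y),
    fun s hs y ↦ ?_, fun s hs y ↦ ?_, fun g ↦ ?_⟩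
  · -- `‖f ((d s) • y)‖ ≤ w y`
    have h : F₁ y s ≤ sSup (F₁ y '' Icc (-1 : ℝ) 1) := le_csSup (hbdd₁ y) (mem_image_of_mem _ hs)
    exact h.trans (le_add_of_nonneg_right (hsup₂_nonneg y))
  · have h : F₂ y s ≤ sSup (F₂ y '' Icc (-1 : ℝ) 1) := le_csSup (hbdd₂ y) (mem_image_of_mem _ hs)
    exact h.trans (le_add_of_nonneg_left (hsup₁_nonneg y))
  · -- the bound at `[g⁻¹]`
    have himg : ∀ (Fy : ℝ → ℝ) (B : ℝ), (∀ s ∈ Icc (-1 : ℝ) 1, Fy s ≤ B) →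
        sSup (Fy '' Icc (-1 : ℝ) 1) ≤ B := by
      intro Fy B hB
      refine csSup_le (hne.image _) ?_
      rintro _ ⟨s, hs, rfl⟩
      exact hB s hs
    have h1 : sSup (F₁ ((AdelicGroupData.gl n K).toAutomorphicQuotient g⁻¹) '' Icc (-1 : ℝ) 1) ≤
        C₁ * c₀ ^ R * (1 ⊔ adelicHeightGL n K g) ^ R := by
      refine himg _ _ fun s hs ↦ ?_
      change ‖f ((d s) • (AdelicGroupData.gl n K).toAutomorphicQuotient g⁻¹)‖ ≤ _
      rw [← inv_inv (d s), ← hdneg]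
      exact hkey f C₁ r₁ hC₁0 (le_max_left _ _) hC₁ (-s) ⟨by linarith [hs.2], by linarith [hs.1]⟩ g
    have h2 : sSup (F₂ ((AdelicGroupData.gl n K).toAutomorphicQuotient g⁻¹) '' Icc (-1 : ℝ) 1) ≤
        C₂ * c₀ ^ R * (1 ⊔ adelicHeightGL n K g) ^ R :=
      himg _ _ fun s hs ↦ hkey f_X C₂ r₂ hC₂0 (le_max_right _ _) hC₂ s hs g
    calc w ((AdelicGroupData.gl n K).toAutomorphicQuotient g⁻¹)
        ≤ C₁ * c₀ ^ R * (1 ⊔ adelicHeightGL n K g) ^ R + C₂ * c₀ ^ R * (1 ⊔ adelicHeightGL n K g) ^ R :=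
          add_le_add h1 h2
      _ = (C₁ * c₀ ^ R + C₂ * c₀ ^ R) * (1 ⊔ adelicHeightGL n K g) ^ R := by ring

variable {μ : Measure (AdelicGroupData.gl n K).automorphicQuotient}
  [(AdelicGroupData.gl n K).IsAutomorphicMeasure μ]

/-- **A weight of moderate growth times a rapidly decreasing function is integrable over the
quotient** (reduction theory). If `w` is continuous, non-negative, with `w([g⁻¹]) ≤ C (1 ⊔ ‖g‖)^R` on
`GL_n(𝔸_K)` (`n ≥ 1`), and `invQuot g` is continuous and rapidly decreasing
(`IsRapidlyDecreasingGL`), then `w |g|` is integrable for every automorphic measure `μ`: the quotient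
integral is dominated by an integral over a Siegel set (`exists_lintegral_le_mul_setLIntegral_siegel`)
where `|g̃| (1 ⊔ ‖·‖)^R` is integrable (`setLIntegral_siegel_enorm_mul_height_rpow_lt_top`).
Moeglin–Waldspurger 1995, I.2.2 (vii) and I.2.18; Getz–Hahn 2024, Thm. 2.7.2 and Thm. 9.8.1.
[cite: MoeglinWaldspurger1995, I.2.2] -/
theorem integrable_weight_mul_norm_of_isRapidlyDecreasingGL (hn : 0 < n)
    {w : (AdelicGroupData.gl n K).automorphicQuotient → ℝ} (hwc : Continuous w) (hw0 : ∀ y, 0 ≤ w y)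
    {C : ℝ} {R : ℕ}
    (hwle : ∀ g : (AdelicGroupData.gl n K).Adelic,
      w ((AdelicGroupData.gl n K).toAutomorphicQuotient g⁻¹) ≤ C * (1 ⊔ adelicHeightGL n K g) ^ R)
    {g : (AdelicGroupData.gl n K).automorphicQuotient → ℂ}
    (hgc : Continuous (invQuot (AdelicGroupData.gl n K) g))
    (hgrd : IsRapidlyDecreasingGL n K (invQuot (AdelicGroupData.gl n K) g)) :
    Integrable (fun y ↦ w y * ‖g y‖) μ := by
  have hgc' : Continuous g := continuous_of_continuous_invQuot hgc
  refine ⟨(hwc.mul hgc'.norm).aestronglyMeasurable, ?_⟩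
  -- a Haar measure on `GL_n(𝔸_K)` for its Borel σ-algebra
  letI : MeasurableSpace (GL (Fin n) (AdeleRing (𝓞 K) K)) := borel _
  haveI : BorelSpace (GL (Fin n) (AdeleRing (𝓞 K) K)) := ⟨rfl⟩
  haveI : T2Space (GL (Fin n) (AdeleRing (𝓞 K) K)) := t2Space_gl n K
  haveI : LocallyCompactSpace (GL (Fin n) (AdeleRing (𝓞 K) K)) :=
    AdelicGroupData.locallyCompactSpace_generalLinearGroup_adeleRing K (Fin n)
  set μG : Measure (GL (Fin n) (AdeleRing (𝓞 K) K)) := haar with hμG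
  obtain ⟨c, Ω, t, Z, hc, ht, hΩc, hΩB, hZc, hZ, hle⟩ :=
    exists_lintegral_le_mul_setLIntegral_siegel n K μ μG
  have hC0 : 0 ≤ C :=
    nonneg_of_le_mul_of_pos (hwle 1) (hw0 _) (pow_pos (lt_of_lt_of_le one_pos le_sup_left) _)
  have hmain := setLIntegral_siegel_enorm_mul_height_rpow_lt_top n K hn μG hgc hgrd
    (N := (R : ℝ)) (Nat.cast_nonneg R) hΩc hΩB ht hZc hZ
  -- compare the integrands on the Siegel set
  change ∫⁻ y, ‖w y * ‖g y‖‖ₑ ∂μ < ⊤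
  refine lt_of_le_of_lt (hle fun y ↦ ‖w y * ‖g y‖‖ₑ) ?_
  refine ENNReal.mul_lt_top hc.lt_top
    (lt_of_le_of_lt ?_ (ENNReal.mul_lt_top (ENNReal.ofReal_lt_top (r := C)) hmain))
  rw [← lintegral_const_mul' (ENNReal.ofReal C) _ ENNReal.ofReal_ne_top]
  refine lintegral_mono fun x ↦ ?_
  -- pointwise: `‖w[x⁻¹] |g [x⁻¹]|‖ₑ ≤ ofReal C * (|g̃ x|ₑ * ofReal ((1 ⊔ ‖x‖)^R))`
  have hwx := hwle x
  have e1 : ‖w ((AdelicGroupData.gl n K).toAutomorphicQuotient x⁻¹) *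
      ‖g ((AdelicGroupData.gl n K).toAutomorphicQuotient x⁻¹)‖‖ₑ =
      ENNReal.ofReal (w ((AdelicGroupData.gl n K).toAutomorphicQuotient x⁻¹)) *
        ‖invQuot (AdelicGroupData.gl n K) g x‖ₑ := by
    rw [enorm_mul, Real.enorm_eq_ofReal (hw0 _), enorm_norm]
    rfl
  rw [e1]
  have e2 : ((1 ⊔ adelicHeightGL n K x) ^ (R : ℝ)) = (1 ⊔ adelicHeightGL n K x) ^ R :=
    Real.rpow_natCast _ R
  rw [e2]
  calc ENNReal.ofReal (w ((AdelicGroupData.gl n K).toAutomorphicQuotient x⁻¹)) *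
        ‖invQuot (AdelicGroupData.gl n K) g x‖ₑ
      ≤ ENNReal.ofReal (C * (1 ⊔ adelicHeightGL n K x) ^ R) * ‖invQuot (AdelicGroupData.gl n K) g x‖ₑ :=
        mul_le_mul' (ENNReal.ofReal_le_ofReal hwx) le_rfl
    _ = ENNReal.ofReal C * (‖invQuot (AdelicGroupData.gl n K) g x‖ₑ *
          ENNReal.ofReal ((1 ⊔ adelicHeightGL n K x) ^ R)) := by
        rw [ENNReal.ofReal_mul hC0]
        ring

/-- **Borel's lemma on `GL_n(𝔸_K) ⧸ A_G GL_n(K)`: integration by parts for moderate growth against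
rapid decay.** Let `μ` be an automorphic measure (`n ≥ 1`), `X ∈ 𝔤`, `f, f_X` continuous on the
quotient with `invQuot f`, `invQuot f_X` of moderate growth (`HasModerateGrowth` for the adelic
height), `invQuot f` smooth in the archimedean variable with `X (invQuot f) = invQuot f_X`; and
`g, g_X` with `invQuot g`, `invQuot g_X` continuous and rapidly decreasing on Siegel sets
(`IsRapidlyDecreasingGL`), `invQuot g` smooth in the archimedean variable with
`X (invQuot g) = invQuot g_X`. Then `∫ f_X ḡ dμ = - ∫ f ḡ_X dμ`. Borel 1997, 11.12 (2) (the identity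
for square integrable data); Moeglin–Waldspurger 1995, I.2.2 and I.2.12, Getz–Hahn 2024, Thm. 2.7.2
and Def. 9.3 for the estimates. [cite: Borel1997, 11.12 (2)] -/
theorem integral_lieDeriv_mul_conj_eq_neg_of_hasModerateGrowth (hn : 0 < n)
    (X : (AutomorphyDatum.gl n K hcpt).arch.lie)
    {f f_X g g_X : (AdelicGroupData.gl n K).automorphicQuotient → ℂ} (hfc : Continuous f)
    (hfXc : Continuous f_X)
    (hfm : HasModerateGrowth (AutomorphyDatum.gl n K hcpt) (invQuot (AdelicGroupData.gl n K) f))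
    (hfXm : HasModerateGrowth (AutomorphyDatum.gl n K hcpt) (invQuot (AdelicGroupData.gl n K) f_X))
    (hφ : IsArchSmooth (AutomorphyDatum.gl n K hcpt).ofArch (invQuot (AdelicGroupData.gl n K) f))
    (hXf : lieDeriv (AutomorphyDatum.gl n K hcpt).ofArch X (invQuot (AdelicGroupData.gl n K) f) =
      invQuot (AdelicGroupData.gl n K) f_X)
    (hgc : Continuous (invQuot (AdelicGroupData.gl n K) g))
    (hgrd : IsRapidlyDecreasingGL n K (invQuot (AdelicGroupData.gl n K) g))
    (hgXc : Continuous (invQuot (AdelicGroupData.gl n K) g_X))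
    (hgXrd : IsRapidlyDecreasingGL n K (invQuot (AdelicGroupData.gl n K) g_X))
    (hψ : IsArchSmooth (AutomorphyDatum.gl n K hcpt).ofArch (invQuot (AdelicGroupData.gl n K) g))
    (hXg : lieDeriv (AutomorphyDatum.gl n K hcpt).ofArch X (invQuot (AdelicGroupData.gl n K) g) =
      invQuot (AdelicGroupData.gl n K) g_X) :
    ∫ y, f_X y * conj (g y) ∂μ = -∫ y, f y * conj (g_X y) ∂μ := by
  obtain ⟨w, C, R, hwc, hw0, hwf, hwfX, hwle⟩ := exists_weight_of_hasModerateGrowth X hfc hfXc hfm hfXm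
  exact integral_lieDeriv_mul_conj_eq_neg_of_dominated (AutomorphyDatum.gl n K hcpt) hfc hfXc
    (continuous_of_continuous_invQuot hgc) (continuous_of_continuous_invQuot hgXc) hφ hψ X hXf hXg
    (integrable_weight_mul_norm_of_isRapidlyDecreasingGL hn hwc hw0 hwle hgc hgrd)
    (integrable_weight_mul_norm_of_isRapidlyDecreasingGL hn hwc hw0 hwle hgXc hgXrd) hwf hwfX

/-! ### 4. `GL_n`: against cusp forms, unconditionally on the cusp-form side -/

/-- **Borel's lemma against cusp forms.** Let `μ` be an automorphic measure on
`GL_n(𝔸_K) ⧸ A_G GL_n(K)` (`n ≥ 1`), `X ∈ 𝔤`, `f, f_X` continuous on the quotient with `invQuot f`,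
`invQuot f_X` of moderate growth, `invQuot f` smooth in the archimedean variable and
`X (invQuot f) = invQuot f_X`; and `g, g_X` functions on the quotient with `invQuot g` in the space
of cusp forms `𝒜₀ = cuspFormsGL n K hcpt` and `X (invQuot g) = invQuot g_X`. Then
`∫ f_X ḡ dμ = - ∫ f ḡ_X dμ`. The cusp-form side is discharged by the tree: `invQuot g_X ∈ 𝒜₀`
(`isStableSubmodule_cuspFormsGL`), elements of `𝒜₀` invariant under `A_G` (as `invQuot` of
anything is, `invQuot_mul_left`) are continuous (`continuous_of_mem_automorphicForms_gl`) and
rapidly decreasing (`IsCuspFormGL.isRapidlyDecreasingGL_of_center'`), and smooth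
(`automorphicForms_le_archSmooth`); Getz–Hahn 2024, Thm. 9.8.1 (printed p. 191) for the rapid decay.
[cite: Borel1997, 11.12 (2)] -/
theorem integral_lieDeriv_mul_conj_cuspFormsGL_eq_neg (hn : 0 < n)
    (X : (AutomorphyDatum.gl n K hcpt).arch.lie)
    {f f_X g g_X : (AdelicGroupData.gl n K).automorphicQuotient → ℂ} (hfc : Continuous f)
    (hfXc : Continuous f_X)
    (hfm : HasModerateGrowth (AutomorphyDatum.gl n K hcpt) (invQuot (AdelicGroupData.gl n K) f))
    (hfXm : HasModerateGrowth (AutomorphyDatum.gl n K hcpt) (invQuot (AdelicGroupData.gl n K) f_X))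
    (hφ : IsArchSmooth (AutomorphyDatum.gl n K hcpt).ofArch (invQuot (AdelicGroupData.gl n K) f))
    (hXf : lieDeriv (AutomorphyDatum.gl n K hcpt).ofArch X (invQuot (AdelicGroupData.gl n K) f) =
      invQuot (AdelicGroupData.gl n K) f_X)
    (hg : invQuot (AdelicGroupData.gl n K) g ∈ cuspFormsGL n K hcpt)
    (hXg : lieDeriv (AutomorphyDatum.gl n K hcpt).ofArch X (invQuot (AdelicGroupData.gl n K) g) =
      invQuot (AdelicGroupData.gl n K) g_X) :
    ∫ y, f_X y * conj (g y) ∂μ = -∫ y, f y * conj (g_X y) ∂μ := by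
  -- the cusp-form side
  have hgX : invQuot (AdelicGroupData.gl n K) g_X ∈ cuspFormsGL n K hcpt := by
    rw [← hXg]
    exact (isStableSubmodule_cuspFormsGL hcpt).lie_stable X _ hg
  have hAG : ∀ u : (AdelicGroupData.gl n K).automorphicQuotient → ℂ,
      ∀ z ∈ (AdelicGroupData.gl n K).center', ∀ x,
        invQuot (AdelicGroupData.gl n K) u (z * x) = invQuot (AdelicGroupData.gl n K) u x :=
    fun u _ hz x ↦ invQuot_mul_left (AdelicGroupData.gl n K) u
      ((AdelicGroupData.gl n K).center'_le_quotientSubgroup hz) x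
  have hcont : ∀ u : (AdelicGroupData.gl n K).automorphicQuotient → ℂ,
      invQuot (AdelicGroupData.gl n K) u ∈ cuspFormsGL n K hcpt →
        Continuous (invQuot (AdelicGroupData.gl n K) u) :=
    fun u hu ↦ continuous_of_mem_automorphicForms_gl (cuspFormsGL_le_automorphicForms n K hcpt hu)
  have hrd : ∀ u : (AdelicGroupData.gl n K).automorphicQuotient → ℂ,
      invQuot (AdelicGroupData.gl n K) u ∈ cuspFormsGL n K hcpt →
        IsRapidlyDecreasingGL n K (invQuot (AdelicGroupData.gl n K) u) :=
    fun u hu ↦ (isCuspFormGL_of_mem_cuspFormsGL' hu).isRapidlyDecreasingGL_of_center' (hAG u)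
  exact integral_lieDeriv_mul_conj_eq_neg_of_hasModerateGrowth hn X hfc hfXc hfm hfXm hφ hXf
    (hcont g hg) (hrd g hg) (hcont g_X hgX) (hrd g_X hgX)
    (automorphicForms_le_archSmooth _ (cuspFormsGL_le_automorphicForms n K hcpt hg)) hXg

/-- **Borel's lemma against cusp forms, data given on `GL_n(𝔸_K)`.** Let `Φ : GL_n(𝔸_K) → ℂ` be
left invariant under `A_G GL_n(K)`, continuous, smooth in the archimedean variable, with `Φ` and
`X Φ` of moderate growth and `X Φ` continuous; let `φ ∈ 𝒜₀ = cuspFormsGL n K hcpt` be invariant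
under `A_G`. With `↓ = AdelicGroupData.descend` (`[y] ↦ · (y⁻¹)`, inverse to `invQuot`):
`∫ (X Φ)↓ · conj φ↓ dμ = - ∫ Φ↓ · conj (X φ)↓ dμ` for every automorphic measure `μ` (`n ≥ 1`)
(the shape used for a closed cuspidal form paired with an invariant primitive of moderate growth).
[cite: Borel1997, 11.12 (2)] -/
theorem integral_descend_lieDeriv_mul_conj_cuspFormsGL_eq_neg (hn : 0 < n)
    (X : (AutomorphyDatum.gl n K hcpt).arch.lie)
    {Φ φ : (AdelicGroupData.gl n K).Adelic → ℂ}
    (hΦinv : ∀ γ ∈ (AdelicGroupData.gl n K).quotientSubgroup, ∀ x, Φ (γ * x) = Φ x)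
    (hΦc : Continuous Φ) (hΦs : IsArchSmooth (AutomorphyDatum.gl n K hcpt).ofArch Φ)
    (hΦm : HasModerateGrowth (AutomorphyDatum.gl n K hcpt) Φ)
    (hΦXc : Continuous (lieDeriv (AutomorphyDatum.gl n K hcpt).ofArch X Φ))
    (hΦXm : HasModerateGrowth (AutomorphyDatum.gl n K hcpt)
      (lieDeriv (AutomorphyDatum.gl n K hcpt).ofArch X Φ))
    (hφ : φ ∈ cuspFormsGL n K hcpt)
    (hφA : ∀ z ∈ (AdelicGroupData.gl n K).center', ∀ x, φ (z * x) = φ x) :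
    ∫ y, (AdelicGroupData.gl n K).descend (lieDeriv (AutomorphyDatum.gl n K hcpt).ofArch X Φ)
          (lieDeriv_apply_mul_of_forall_apply_mul (AutomorphyDatum.gl n K hcpt) hΦinv X) y *
        conj ((AdelicGroupData.gl n K).descend φ
          ((AdelicGroupData.gl n K).leftInvariant_quotientSubgroup
            (isLeftInvariant_of_mem_automorphicForms (cuspFormsGL_le_automorphicForms n K hcpt hφ))
            hφA) y) ∂μ =
      -∫ y, (AdelicGroupData.gl n K).descend Φ hΦinv y *
        conj ((AdelicGroupData.gl n K).descend (lieDeriv (AutomorphyDatum.gl n K hcpt).ofArch X φ)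
          ((AdelicGroupData.gl n K).leftInvariant_quotientSubgroup
            (isLeftInvariant_of_mem_automorphicForms (cuspFormsGL_le_automorphicForms n K hcpt
              ((isStableSubmodule_cuspFormsGL hcpt).lie_stable X φ hφ)))
            (lieDeriv_apply_center'_mul hφA X)) y) ∂μ := by
  refine integral_lieDeriv_mul_conj_cuspFormsGL_eq_neg (hcpt := hcpt) hn X ?_ ?_ ?_ ?_ ?_ ?_ ?_ ?_
  · exact continuous_of_continuous_invQuot (by rwa [AdelicGroupData.invQuot_descend])
  · exact continuous_of_continuous_invQuot (by rwa [AdelicGroupData.invQuot_descend])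
  · rwa [AdelicGroupData.invQuot_descend]
  · rwa [AdelicGroupData.invQuot_descend]
  · rwa [AdelicGroupData.invQuot_descend]
  · rw [AdelicGroupData.invQuot_descend, AdelicGroupData.invQuot_descend]
  · rwa [AdelicGroupData.invQuot_descend]
  · rw [AdelicGroupData.invQuot_descend, AdelicGroupData.invQuot_descend]

/-! ### 5. The same identities with the conjugation on the moderate-growth side

For pairings that are conjugate-linear in the FIRST variable (Mathlib's convention for inner
products, and the convention of `Kuga.IsPosForm` / `KugaDegreeOneInjectivity`): `B Ψ y = ∫ Ψ̄ y dμ`. -/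

omit [(AdelicGroupData.gl n K).IsAutomorphicMeasure μ] in
/-- From `∫ a b̄ = -∫ c ē` to `∫ ā b + ∫ c̄ e = 0` (complex conjugation of both sides,
`integral_conj`). [folklore] -/
private theorem integral_conj_mul_add_eq_zero_of_eq_neg
    {a b c e : (AdelicGroupData.gl n K).automorphicQuotient → ℂ}
    (h : ∫ y, a y * conj (b y) ∂μ = -∫ y, c y * conj (e y) ∂μ) :
    (∫ y, conj (a y) * b y ∂μ) + ∫ y, conj (c y) * e y ∂μ = 0 := by
  have h' := congrArg conj h
  rw [map_neg, ← integral_conj, ← integral_conj] at h'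
  simp only [map_mul, Complex.conj_conj] at h'
  rw [h', neg_add_cancel]

/-- **Borel's lemma, conjugate-linear form**: under the hypotheses of
`integral_lieDeriv_mul_conj_eq_neg_of_hasModerateGrowth`,
`∫ f̄_X g dμ + ∫ f̄ g_X dμ = 0` — i.e. `B (X Ψ) y = - B Ψ (X y)` for the pairing `B Ψ y = ∫ Ψ̄ y dμ`
of a function of moderate growth with a rapidly decreasing one (the hypothesis `hπ` of
`Kuga.Setup.eq_zero_of_pairedPrimitive`). [cite: Borel1997, 11.12 (2)] -/
theorem integral_conj_lieDeriv_mul_add_eq_zero_of_hasModerateGrowth (hn : 0 < n)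
    (X : (AutomorphyDatum.gl n K hcpt).arch.lie)
    {f f_X g g_X : (AdelicGroupData.gl n K).automorphicQuotient → ℂ} (hfc : Continuous f)
    (hfXc : Continuous f_X)
    (hfm : HasModerateGrowth (AutomorphyDatum.gl n K hcpt) (invQuot (AdelicGroupData.gl n K) f))
    (hfXm : HasModerateGrowth (AutomorphyDatum.gl n K hcpt) (invQuot (AdelicGroupData.gl n K) f_X))
    (hφ : IsArchSmooth (AutomorphyDatum.gl n K hcpt).ofArch (invQuot (AdelicGroupData.gl n K) f))
    (hXf : lieDeriv (AutomorphyDatum.gl n K hcpt).ofArch X (invQuot (AdelicGroupData.gl n K) f) =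
      invQuot (AdelicGroupData.gl n K) f_X)
    (hgc : Continuous (invQuot (AdelicGroupData.gl n K) g))
    (hgrd : IsRapidlyDecreasingGL n K (invQuot (AdelicGroupData.gl n K) g))
    (hgXc : Continuous (invQuot (AdelicGroupData.gl n K) g_X))
    (hgXrd : IsRapidlyDecreasingGL n K (invQuot (AdelicGroupData.gl n K) g_X))
    (hψ : IsArchSmooth (AutomorphyDatum.gl n K hcpt).ofArch (invQuot (AdelicGroupData.gl n K) g))
    (hXg : lieDeriv (AutomorphyDatum.gl n K hcpt).ofArch X (invQuot (AdelicGroupData.gl n K) g) =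
      invQuot (AdelicGroupData.gl n K) g_X) :
    (∫ y, conj (f_X y) * g y ∂μ) + ∫ y, conj (f y) * g_X y ∂μ = 0 :=
  integral_conj_mul_add_eq_zero_of_eq_neg
    (integral_lieDeriv_mul_conj_eq_neg_of_hasModerateGrowth hn X hfc hfXc hfm hfXm hφ hXf hgc hgrd
      hgXc hgXrd hψ hXg)

/-- **Borel's lemma against cusp forms, conjugate-linear form**: under the hypotheses of
`integral_lieDeriv_mul_conj_cuspFormsGL_eq_neg` (`invQuot g ∈ 𝒜₀`, `X (invQuot g) = invQuot g_X`;
`f, f_X` continuous of moderate growth with `X (invQuot f) = invQuot f_X`),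
`∫ f̄_X g dμ + ∫ f̄ g_X dμ = 0`. [cite: Borel1997, 11.12 (2)] -/
theorem integral_conj_lieDeriv_mul_add_eq_zero_cuspFormsGL (hn : 0 < n)
    (X : (AutomorphyDatum.gl n K hcpt).arch.lie)
    {f f_X g g_X : (AdelicGroupData.gl n K).automorphicQuotient → ℂ} (hfc : Continuous f)
    (hfXc : Continuous f_X)
    (hfm : HasModerateGrowth (AutomorphyDatum.gl n K hcpt) (invQuot (AdelicGroupData.gl n K) f))
    (hfXm : HasModerateGrowth (AutomorphyDatum.gl n K hcpt) (invQuot (AdelicGroupData.gl n K) f_X))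
    (hφ : IsArchSmooth (AutomorphyDatum.gl n K hcpt).ofArch (invQuot (AdelicGroupData.gl n K) f))
    (hXf : lieDeriv (AutomorphyDatum.gl n K hcpt).ofArch X (invQuot (AdelicGroupData.gl n K) f) =
      invQuot (AdelicGroupData.gl n K) f_X)
    (hg : invQuot (AdelicGroupData.gl n K) g ∈ cuspFormsGL n K hcpt)
    (hXg : lieDeriv (AutomorphyDatum.gl n K hcpt).ofArch X (invQuot (AdelicGroupData.gl n K) g) =
      invQuot (AdelicGroupData.gl n K) g_X) :
    (∫ y, conj (f_X y) * g y ∂μ) + ∫ y, conj (f y) * g_X y ∂μ = 0 :=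
  integral_conj_mul_add_eq_zero_of_eq_neg
    (integral_lieDeriv_mul_conj_cuspFormsGL_eq_neg hn X hfc hfXc hfm hfXm hφ hXf hg hXg)

end GLn

end Literature.NumberTheory.Automorphic

end
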